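import Literature.Probability.RandomPlanarGeometry.RestrictionContinuity
import Literature.Probability.RandomPlanarGeometry.RestrictionExponentHalf
import Literature.Probability.RandomPlanarGeometry.JoukowskiArcHulls
import Literature.Probability.RandomPlanarGeometry.HullSubordination
import Literature.Probability.RandomPlanarGeometry.PlusHullExtension
import HarnessLib

/-!
# [LSW] Proposition 3.3, (1) ⇒ (3), assembled from Lemma 3.5

G. F. Lawler, O. Schramm, W. Werner, *Conformal restriction: the chordal case*, J. Amer. Math.
Soc. **16** (2003) 917–955, arXiv:math/0209343 (**[LSW]**, arXiv page numbers), Prop. 3.3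
(pp. 10–11) and its proof (pp. 11–13). This proof-only file DISCHARGES the named fact
`Literature.Probability.RandomPlanarGeometry.exists_isRestrictionMeasure_of_isHullMultiplicative`
(`RestrictionMeasures`: "a probability measure on `Ω` which is `Γ`-invariant and `𝒜₁`-covariant
is `P_α` for some `α > 0`", (1) ⇒ (3) of Prop. 3.3, in homomorphism form) RELATIVE TO the two
clauses of [LSW] Lemma 3.5 that are named facts of the tree:

* `LSWConverges.tendsto_measure_avoid` (`RestrictionContinuity`): `F` is continuous;
* `IsPlusHull.exists_isLSWGenerated_lswConverges` (`RestrictionDensity`): `𝒜₀` is dense in `𝒬₊`;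

see `exists_isRestrictionMeasure_of_isHullMultiplicative_of_lemma35`. Everything else in the
printed proof is PROVED here or earlier in the tree:

1. **`F(K_t) = e^{-2αt}`, `α ≥ 0`** (p. 11) — `exists_measure_avoid_lswHull_eq_exp`: `t ↦ F(K_t)`
   is multiplicative (`K_{s+t} = K_t · K_s`, `LoewnerSemigroup.isHullProduct_lswHull`),
   non-increasing, tends to `1` as `t ↓ 0` (`K_t ⊆ B̄(1, 2t + 4√t)` and `1 ∉ cl K`), hence
   positive, and `-log F(K_t)` is additive and monotone, hence linear
   (`eq_mul_of_monotone_of_map_add`);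
2. **`F = Φ'(0)^α` on `𝒜₀`** — `RestrictionDensity.IsLSWGenerated.measure_avoid_eq_rpow`; here we
   add `𝒜₀ ⊆ 𝒬₊` (`IsLSWGenerated.isPlusHull`), via **`𝒬₊` is a semigroup**
   (`IsPlusHull.of_isHullProduct`, §2 p. 8, by the boundary behaviour of the Schwarz-reflection
   extension of `Φ_{A'}`, `PlusHullExtension`);
3. **`F = Φ'(0)^α` on `𝒬₊`** ((3.3), p. 11) — `measure_avoid_eq_rpow_of_isPlusHull`, from 2, the
   two clauses of Lemma 3.5 and `Φ'_{A_n}(0) → Φ'_A(0)`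
   (`RestrictionDensity.LSWConverges.tendsto_restrictionDeriv`, the third clause, proved);
4. **`F = Φ'(0)^{α₋}` on `𝒬₋`** ("By symmetry", p. 13) — `exists_measure_avoid_eq_rpow_of_isMinusHull`:
   the mirror image `σ_* P` again satisfies (1) (`IsScaleInvariant.map_reflect`,
   `IsHullMultiplicative.map_reflect`, via `σ(A · A') = σA · σA'`, `IsHullProduct.image_imagAxisRefl`);
5. **`α₋ = α`** (p. 13) — `restrictionExponent_minus_eq`, with [LSW]'s symmetric pair of arcs for `ε = π/3`,
   `A = circArcHull (-1) 1` (`JoukowskiArcHulls`: `Φ_A'(0) = 1/4`): `A = A₁ · A₋ = σA₁ · σA₋`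
   gives `d₁^α d₂^{α₋} = d₁^{α₋} d₂^α` (`dᵢ` the derivatives of the factors), and `d₁ ≠ d₂` since
   `d₁ d₂ = 1/4` while `d₂ ≥ 9/16` by monotonicity (`HullSubordination`) — this replaces the
   limit `ε ↓ 0` of the printed argument by one explicit value;
6. **`𝒬*`** — `A = A₁ · A₂` with `A₁ ∈ 𝒬₊`, `A₂ ∈ 𝒬₋`
   (`IsStarHull.exists_isHullProduct_plus_minus_holds`) and the chain rule for `Φ'(0)`;
7. **`α > 0`** ("The case `α = 0` clearly implies `K = ∅` a.s.", p. 13) — `restrictionExponent_pos`: the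
   arcs `circArcHull (-2) q`, `q ↓ -2`, exhaust the unit semicircle, which every `K ∈ Ω` meets
   (`RestrictionConfig.exists_mem_norm_eq_one`, `RestrictionExponentHalf`).

## References

* [LSW] Prop. 3.3 and its proof, arXiv pp. 10–13 [LawlerSchrammWerner2003Restriction].
-/

noncomputable section

open Set Filter Metric MeasureTheory Bornology Complex
open _root_.Topology
open UpperHalfPlane (upperHalfPlaneSet isOpen_upperHalfPlaneSet)
open scoped NNReal ENNReal ComplexConjugate Pointwise

namespace Literature.Probability.RandomPlanarGeometry

open RestrictionConfig


/-! ### `𝒬₊` is a semigroup ([LSW] §2 p. 8) -/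

/-- Dilations preserve `𝒬₊`: `λA ∈ 𝒬₊` for `A ∈ 𝒬₊`, `λ > 0`. [folklore] -/
theorem IsPlusHull.smul {A : Set ℂ} (hA : IsPlusHull A) {r : ℝ} (hr : 0 < r) : IsPlusHull (r • A) := by
  refine ⟨hA.1.smul hr, fun x hx ↦ ?_⟩
  obtain ⟨a, haA, hax⟩ := Set.mem_smul_set.1 hx
  have ha : a = ((x / r : ℝ) : ℂ) := by
    have h1 : a = r⁻¹ • (r • a) := by rw [smul_smul, inv_mul_cancel₀ hr.ne', one_smul]
    rw [h1, hax, Complex.real_smul]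
    push_cast
    field_simp
  rw [ha] at haA
  have := hA.2 _ haA
  exact (div_pos_iff_of_pos_right hr).1 this

/-- **`𝒬₊` is a semigroup** ([LSW] §2 p. 8: "Note that `𝒬₊`, `𝒬₋` are semigroups"): if
`B = A · A'` with `A, A' ∈ 𝒬₊` then `B ∈ 𝒬₊`. A real point `x < 0` of `B` would be a limit of
points `z_k ∈ B ∩ ℍ`; either infinitely many lie in `A'` (then `x ∈ A'`, impossible), or
`Φ_{A'}(z_k) ∈ A` eventually, and by the continuity of the Schwarz-reflection extension `E_{A'}`
of `Φ_{A'}` at `x` (`PlusHullExtension`), `E_{A'}(x) ∈ A` would be a real point of `A` with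
`E_{A'}(x) < E_{A'}(0) = 0` (`E_{A'}` is increasing on `(-∞, x₀)`), impossible.
[cite: LawlerSchrammWerner2003Restriction, §2 p. 8 (±-hulls are semigroups)] -/
theorem IsPlusHull.of_isHullProduct {A A' B : Set ℂ} (hA : IsPlusHull A) (hA' : IsPlusHull A')
    (hB : IsHullProduct A A' B) : IsPlusHull B := by
  obtain ⟨hBstar, Φ', hΦ', hset⟩ := hB
  refine ⟨hBstar, fun x hx ↦ ?_⟩
  have hx0 : x ≠ 0 := by
    rintro rfl
    exact hBstar.2 (by simpa using hx)
  rcases lt_or_gt_of_ne hx0 with hneg | hpos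
  swap
  · exact hpos
  exfalso
  -- `x` is a limit of points of `B ∩ ℍ`
  have hxcl : ((x : ℝ) : ℂ) ∈ closure (B ∩ upperHalfPlaneSet) := by
    rw [hBstar.1.closure_inter_eq]; exact hx
  obtain ⟨z, hzmem, hzlim⟩ := mem_closure_iff_seq_limit.1 hxcl
  -- points of `B ∩ ℍ` lie in `A'` or are mapped into `A` by `Φ_{A'}`
  have hdec : ∀ k, z k ∉ A' → z k ∈ upperHalfPlaneSet \ A' ∧ Φ' (z k) ∈ A := fun k hzA' ↦ by
    have hzH : z k ∈ upperHalfPlaneSet \ A' := ⟨(hzmem k).2, hzA'⟩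
    refine ⟨hzH, ?_⟩
    by_contra hnot
    have : z k ∈ upperHalfPlaneSet \ B := by rw [hset]; exact ⟨hzH, hnot⟩
    exact this.2 (hzmem k).1
  by_cases hfr : ∃ᶠ k in atTop, z k ∈ A'
  · -- infinitely many `z_k ∈ A'`: `x ∈ A'`
    have hxA' : ((x : ℝ) : ℂ) ∈ A' := by
      have := mem_closure_of_frequently_of_tendsto hfr hzlim
      rwa [hA'.1.isBoundedHull.isClosed.closure_eq] at this
    linarith [hA'.2 x hxA']
  -- eventually `z_k ∉ A'` and `Φ_{A'}(z_k) ∈ A`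
  have hev : ∀ᶠ k in atTop, z k ∈ upperHalfPlaneSet \ A' ∧ Φ' (z k) ∈ A := by
    filter_upwards [not_frequently.1 hfr] with k hk using hdec k hk
  rcases A'.eq_empty_or_nonempty with hA'e | hne
  · -- `A' = ∅`: `Φ'` is the identity on `ℍ`, so `z_k ∈ A` eventually and `x ∈ A`
    subst hA'e
    obtain ⟨Φ₀, -, hU⟩ := IsStarHull.existsUnique_isRestrictionMap_holds isStarHull_empty
    have hid : ∀ w ∈ upperHalfPlaneSet \ (∅ : Set ℂ), Φ' w = w := fun w hw ↦ by
      rw [hU Φ' hΦ' hw, ← hU restrictionMapEmpty isRestrictionMap_empty hw, restrictionMapEmpty_apply]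
    have hev' : ∃ᶠ k in atTop, z k ∈ A := by
      refine Eventually.frequently (hev.mono fun k hk ↦ ?_)
      rw [← hid _ hk.1]; exact hk.2
    have hxA : ((x : ℝ) : ℂ) ∈ A := by
      have := mem_closure_of_frequently_of_tendsto hev' hzlim
      rwa [hA.1.isBoundedHull.isClosed.closure_eq] at this
    linarith [hA.2 x hxA]
  · -- `A' ≠ ∅`: use the extension `E_{A'}`
    have hxΩ : ((x : ℝ) : ℂ) ∈ plusDomain A' :=
      hA'.ofReal_mem_plusDomain_of_lt hne (hneg.trans (hA'.leftPt_pos hne))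
    have hcont : ContinuousAt (hA'.extMap hne) x :=
      (hA'.continuousOn_extMap hne).continuousAt (hA'.isOpen_plusDomain.mem_nhds hxΩ)
    have hlim : Tendsto (fun k ↦ hA'.extMap hne (z k)) atTop (𝓝 (hA'.extMap hne x)) :=
      hcont.tendsto.comp hzlim
    have hev' : ∀ᶠ k in atTop, hA'.extMap hne (z k) ∈ A := by
      filter_upwards [hev] with k hk
      rw [hA'.extMap_of_mem_diff hne hk.1, ← hA'.eqOn_baseMap hne hΦ' hk.1]
      exact hk.2
    have hmem : hA'.extMap hne x ∈ A := hA.1.isBoundedHull.isClosed.mem_of_tendsto hlim hev'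
    rw [hA'.extMap_ofReal hne hxΩ] at hmem
    have hpos' := hA.2 _ hmem
    -- but `realExt x < realExt 0 = 0`
    have hlt : hA'.realExt hne x < hA'.realExt hne 0 :=
      hA'.strictMonoOn_realExt_Iio hne (hneg.trans (hA'.leftPt_pos hne)) (hA'.leftPt_pos hne) hneg
    rw [hA'.realExt_zero hne] at hlt
    linarith

/-- **`𝒜₀ ⊆ 𝒬₊`**: the semigroup generated by the dilated Loewner hulls `λK_t ∈ 𝒬₊` consists
of `+`-hulls. [cite: LawlerSchrammWerner2003Restriction, Prop. 3.3 proof (p. 11), 𝒜₀ ⊆ 𝒬₊] -/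
theorem IsLSWGenerated.isPlusHull {A : Set ℂ} (h : IsLSWGenerated A) : IsPlusHull A := by
  induction h with
  | smul_lswHull hr t => exact (isPlusHull_lswHull t).smul hr
  | of_isHullProduct _ _ hB ih ih' => exact ih.of_isHullProduct ih' hB

/-! ### Reflection: products and hypothesis (1) under `σ : x + iy ↦ -x + iy` -/

/-- **`σ(A · A') = σ(A) · σ(A')`**: the mirror image of a product hull is the product of the
mirror images (with the reflected restriction map `σ ∘ Φ_{A'} ∘ σ` of `σ(A')`).
[cite: LawlerSchrammWerner2003Restriction, §2 p. 8 (𝒬₋ = σ(𝒬₊), semigroups)] -/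
theorem RestrictionConfig.IsHullProduct.image_imagAxisRefl {A A' B : Set ℂ} (hA' : IsStarHull A')
    (h : IsHullProduct A A' B) :
    IsHullProduct (imagAxisRefl '' A) (imagAxisRefl '' A') (imagAxisRefl '' B) := by
  obtain ⟨hB, Φ', hΦ', hset⟩ := h
  have hA'c : IsClosed A' := hA'.isBoundedHull.isClosed
  refine ⟨hB.image_imagAxisRefl, Φ'.reflectHull hA'c, hΦ'.reflectHull hA'c, ?_⟩
  rw [← imagAxisRefl_image_diff, hset]
  ext w
  simp only [mem_image, mem_setOf_eq, ConformalEquiv.reflectHull_apply]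
  constructor
  · rintro ⟨z, ⟨hz, hzA⟩, rfl⟩
    refine ⟨?_, ?_⟩
    · rw [← imagAxisRefl_image_diff]; exact mem_image_of_mem _ hz
    · rw [imagAxisRefl_imagAxisRefl]
      rintro ⟨v, hv, hveq⟩
      have : v = Φ' z := by simpa using congrArg imagAxisRefl hveq
      exact hzA (this ▸ hv)
  · rintro ⟨hw, hwA⟩
    refine ⟨imagAxisRefl w, ⟨?_, fun hzA ↦ hwA ⟨_, hzA, rfl⟩⟩, imagAxisRefl_imagAxisRefl w⟩
    rw [← imagAxisRefl_image_diff] at hw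
    obtain ⟨z, hz, rfl⟩ := hw
    rwa [imagAxisRefl_imagAxisRefl]

/-- `σ(λA) = λσ(A)` (`σ` is real-linear). [folklore] -/
theorem imagAxisRefl_image_smul (r : ℝ) (A : Set ℂ) : imagAxisRefl '' (r • A) = r • imagAxisRefl '' A :=
  image_smul_comm imagAxisRefl r A fun z ↦ by simp [Complex.real_smul, map_mul]

section Reflect

variable {P : Measure RestrictionConfig}

/-- `(σ_* P)[K ∩ A = ∅] = P[K ∩ σ(A) = ∅]` for `A ∈ 𝒬*`. [folklore] -/
theorem RestrictionConfig.map_reflect_avoid (P : Measure RestrictionConfig) {A : Set ℂ} (hA : IsStarHull A) :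
    P.map reflect (avoid A) = P (avoid (imagAxisRefl '' A)) := by
  rw [Measure.map_apply measurable_reflect (measurableSet_avoid hA), reflect_preimage_avoid]

/-- The mirror image of a dilation-invariant law is dilation invariant. [folklore] -/
theorem RestrictionConfig.IsScaleInvariant.map_reflect (h : IsScaleInvariant P) :
    IsScaleInvariant (P.map reflect) := by
  intro A hA r hr
  rw [map_reflect_avoid P (hA.smul hr), map_reflect_avoid P hA, imagAxisRefl_image_smul,
    h _ hA.image_imagAxisRefl r hr]

/-- The mirror image of a law multiplicative over products is multiplicative over products
(`σ` permutes the products). [folklore] -/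
theorem RestrictionConfig.IsHullMultiplicative.map_reflect (h : IsHullMultiplicative P) :
    IsHullMultiplicative (P.map reflect) := by
  intro A A' B hA hA' hB
  rw [map_reflect_avoid P hB.1, map_reflect_avoid P hA, map_reflect_avoid P hA',
    h _ _ _ hA.image_imagAxisRefl hA'.image_imagAxisRefl (hB.image_imagAxisRefl hA')]

end Reflect

/-! ### `F(K_t) = e^{-2αt}` along the Loewner semigroup -/

section Semigroup

variable {P : Measure RestrictionConfig}

/-- `{K ∩ B = ∅} ⊆ {K ∩ A = ∅}` for `A ⊆ B`. [folklore] -/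
theorem RestrictionConfig.avoid_mono {A B : Set ℂ} (h : A ⊆ B) : avoid B ⊆ avoid A :=
  fun _ hK ↦ hK.mono_right h

/-- **`F(K_{s+t}) = F(K_t) F(K_s)`** from `K_{s+t} = K_t · K_s` and multiplicativity ([LSW] p. 11:
"Since `F` is a homomorphism, this implies that `F(G_t) = exp(-2αt)` …").
[cite: LawlerSchrammWerner2003Restriction, Prop. 3.3 proof (p. 11)] -/
theorem measure_avoid_lswHull_add (hmul : IsHullMultiplicative P) (s t : ℝ≥0) :
    P (avoid (lswHull (s + t))) = P (avoid (lswHull t)) * P (avoid (lswHull s)) :=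
  hmul _ _ _ (isStarHull_lswHull t) (isStarHull_lswHull s) (isHullProduct_lswHull s t)

/-- `t ↦ F(K_t)` is non-increasing (the hulls increase). [folklore] -/
theorem measure_avoid_lswHull_antitone (P : Measure RestrictionConfig) :
    Antitone fun t ↦ P (avoid (lswHull t)) :=
  fun _ _ hst ↦ measure_mono (avoid_mono (lswHull_mono hst))

/-- **`⋃_{t>0} {K ∩ K_t = ∅} = Ω`** ([LSW] p. 11: "Since `⋂_{t>0} K_t = {1}` and `1 ∉ K`"): every
configuration is at positive distance from `1 ∉ cl K`, and `K_t ⊆ B̄(1, 2t + 4√t)`. [cite: LawlerSchrammWerner2003Restriction, Prop. 3.3 proof (p. 11)] -/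
theorem iUnion_avoid_lswHull :
    (⋃ n : ℕ, avoid (lswHull ((n : ℝ≥0) + 1)⁻¹)) = univ := by
  refine eq_univ_of_forall fun K ↦ ?_
  have h1 : (1 : ℂ) ∉ closure (K : Set ℂ) := fun h ↦ by
    have : (1 : ℂ) ∈ closure (K : Set ℂ) ∩ range ((↑) : ℝ → ℂ) := ⟨h, 1, by simp⟩
    rw [K.closure_inter_range_ofReal] at this
    simp at this
  rw [Metric.mem_closure_iff] at h1
  push Not at h1
  obtain ⟨ε, hε, hfar⟩ := h1
  -- choose `n` with `t = 1/(n+1) < min 1 (ε/6)²`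
  obtain ⟨n, hn⟩ := exists_nat_one_div_lt (lt_min one_pos (by positivity : (0 : ℝ) < (ε / 6) ^ 2))
  refine mem_iUnion.2 ⟨n, ?_⟩
  set t : ℝ≥0 := ((n : ℝ≥0) + 1)⁻¹ with ht
  have htR : (t : ℝ) = 1 / ((n : ℝ) + 1) := by simp [ht]
  have ht0 : 0 ≤ (t : ℝ) := t.2
  have ht1 : (t : ℝ) < 1 := by rw [htR]; exact (hn.trans_le (min_le_left _ _))
  have htε : (t : ℝ) < (ε / 6) ^ 2 := by rw [htR]; exact (hn.trans_le (min_le_right _ _))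
  have hsqrt : Real.sqrt t < ε / 6 := by
    rw [Real.sqrt_lt' (by positivity)]; exact htε
  have htle : (t : ℝ) ≤ Real.sqrt t := Real.le_sqrt_of_sq_le (by nlinarith)
  refine Set.disjoint_left.2 fun z hzK hzt ↦ ?_
  have hz := lswHull_subset_closedBall t hzt
  rw [mem_closedBall] at hz
  have := hfar z hzK
  rw [dist_comm] at this
  linarith

/-- **`F(K_t) → 1` as `t ↓ 0`** (continuity of `P` along `⋃_{t>0} {K ∩ K_t = ∅} = Ω`).
[cite: LawlerSchrammWerner2003Restriction, Prop. 3.3 proof (p. 11)] -/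
theorem tendsto_measure_avoid_lswHull (P : Measure RestrictionConfig) [IsProbabilityMeasure P] :
    Tendsto (fun n : ℕ ↦ P (avoid (lswHull ((n : ℝ≥0) + 1)⁻¹))) atTop (𝓝 1) := by
  have hmono : Monotone fun n : ℕ ↦ avoid (lswHull ((n : ℝ≥0) + 1)⁻¹) := by
    intro n m hnm
    refine avoid_mono (lswHull_mono ?_)
    gcongr
  have := tendsto_measure_iUnion_atTop (μ := P) hmono
  rwa [iUnion_avoid_lswHull, measure_univ] at this

/-- `F(K_0) = 1` (`K_0 ⊆ K_t` for all `t` and `F(K_t) → 1`). [folklore] -/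
theorem measure_avoid_lswHull_zero (P : Measure RestrictionConfig) [IsProbabilityMeasure P] :
    P (avoid (lswHull 0)) = 1 :=
  le_antisymm prob_le_one (le_of_tendsto' (tendsto_measure_avoid_lswHull P)
    fun _ ↦ measure_avoid_lswHull_antitone P zero_le)

/-- `F(K_{n u}) = F(K_u)^n`. [folklore] -/
theorem measure_avoid_lswHull_nat_mul [IsProbabilityMeasure P] (hmul : IsHullMultiplicative P)
    (u : ℝ≥0) (n : ℕ) : P (avoid (lswHull (n * u))) = P (avoid (lswHull u)) ^ n := by
  induction n with
  | zero => simp [measure_avoid_lswHull_zero P]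
  | succ n ih =>
    have : ((n + 1 : ℕ) : ℝ≥0) * u = n * u + u := by push_cast; ring
    rw [this, measure_avoid_lswHull_add hmul, ih, pow_succ, mul_comm]

/-- **`F(K_t) > 0` for all `t`** ([LSW] p. 11: "`F(G_t) = 0` for all `t > 0` … would imply that
`K ∩ K_t ≠ ∅` a.s., for all `t > 0`. Since `⋂_{t>0} K_t = {1}` and `1 ∉ K`, this is ruled out"):
`F(K_u) > 0` for some small `u = 1/(N+1)` and `F(K_t) ≥ F(K_{mu}) = F(K_u)^m > 0` for `t ≤ mu`.
[cite: LawlerSchrammWerner2003Restriction, Prop. 3.3 proof (p. 11)] -/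
theorem measure_avoid_lswHull_ne_zero [IsProbabilityMeasure P] (hmul : IsHullMultiplicative P)
    (t : ℝ≥0) : P (avoid (lswHull t)) ≠ 0 := by
  have hev := (tendsto_order.1 (tendsto_measure_avoid_lswHull P)).1 0 zero_lt_one
  obtain ⟨N, hN⟩ := hev.exists
  set u : ℝ≥0 := ((N : ℝ≥0) + 1)⁻¹ with hu
  have hu0 : 0 < u := by rw [hu]; positivity
  -- `t ≤ m u` for some `m`
  obtain ⟨m, hm⟩ := Archimedean.arch t hu0
  rw [nsmul_eq_mul] at hm
  have h1 : P (avoid (lswHull (m * u))) ≤ P (avoid (lswHull t)) := measure_avoid_lswHull_antitone P hm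
  have h2 : P (avoid (lswHull (m * u))) ≠ 0 := by
    rw [measure_avoid_lswHull_nat_mul hmul]
    exact pow_ne_zero _ hN.ne'
  exact fun h0 ↦ h2 (le_antisymm (h0 ▸ h1) zero_le)

/-- A monotone additive function on `ℝ≥0` is linear: `g(t) = t · g(1)`. [folklore] -/
theorem eq_mul_of_monotone_of_map_add {g : ℝ≥0 → ℝ} (hmono : Monotone g)
    (hadd : ∀ s t, g (s + t) = g s + g t) (t : ℝ≥0) : g t = t * g 1 := by
  have hg0 : g 0 = 0 := by have := hadd 0 0; simpa using this
  have hnat : ∀ (n : ℕ) (u : ℝ≥0), g (n * u) = n * g u := by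
    intro n u
    induction n with
    | zero => simp [hg0]
    | succ n ih =>
      have : ((n + 1 : ℕ) : ℝ≥0) * u = n * u + u := by push_cast; ring
      rw [this, hadd, ih]; push_cast; ring
  have hc0 : 0 ≤ g 1 := by rw [← hg0]; exact hmono zero_le_one
  -- `g(m/n) = (m/n) g(1)`
  have hrat : ∀ m n : ℕ, 0 < n → g ((m : ℝ≥0) / n) = (m / n : ℝ) * g 1 := by
    intro m n hn
    have hn' : (n : ℝ≥0) ≠ 0 := by exact_mod_cast hn.ne'
    have h1 : g 1 = n * g ((n : ℝ≥0)⁻¹) := by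
      rw [← hnat n]; rw [mul_inv_cancel₀ hn']
    have h2 : g ((m : ℝ≥0) / n) = m * g ((n : ℝ≥0)⁻¹) := by rw [div_eq_mul_inv, hnat]
    rw [h2, h1]
    field_simp
  -- squeeze between `⌊nt⌋/n` and `(⌊nt⌋+1)/n`
  refine le_antisymm ?_ ?_ <;> refine le_of_forall_pos_lt_add fun ε hε ↦ ?_ <;>
    obtain ⟨n, hn⟩ := exists_nat_gt (g 1 / ε) <;>
    have hn0 : 0 < n := by
      rcases Nat.eq_zero_or_pos n with rfl | h
      · exfalso; simp at hn; exact absurd hn (not_lt.2 (div_nonneg hc0 hε.le))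
      · exact h
  · -- upper bound: `g t ≤ g ((m+1)/n) = ((m+1)/n) g 1 ≤ t g 1 + g 1 / n < t g 1 + ε`
    set m := ⌊(t : ℝ≥0) * n⌋₊ with hm
    have hle : t ≤ ((m + 1 : ℕ) : ℝ≥0) / n := by
      rw [le_div_iff₀ (by exact_mod_cast hn0)]
      exact_mod_cast (Nat.lt_floor_add_one ((t : ℝ≥0) * n)).le
    have hfl : ((m : ℝ≥0) : ℝ) ≤ (t : ℝ) * n := by exact_mod_cast Nat.floor_le zero_le
    have hnR : (0 : ℝ) < n := by exact_mod_cast hn0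
    calc g t ≤ g (((m + 1 : ℕ) : ℝ≥0) / n) := hmono hle
      _ = ((m + 1 : ℕ) / n : ℝ) * g 1 := hrat _ _ hn0
      _ ≤ (t : ℝ) * g 1 + g 1 / n := by
          push_cast
          rw [add_div, add_mul]
          gcongr ?_ + ?_
          · exact mul_le_mul_of_nonneg_right ((div_le_iff₀ hnR).2 hfl) hc0
          · rw [div_mul_eq_mul_div, one_mul]
      _ < (t : ℝ) * g 1 + ε := by
          gcongr
          rw [div_lt_iff₀ hnR]
          rw [div_lt_iff₀ hε] at hn
          linarith
  · -- lower bound: `t g 1 ≤ (m/n) g 1 + g 1/n ≤ g t + g 1 / n < g t + ε`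
    set m := ⌊(t : ℝ≥0) * n⌋₊ with hm
    have hle : ((m : ℕ) : ℝ≥0) / n ≤ t := by
      rw [div_le_iff₀ (by exact_mod_cast hn0)]
      exact Nat.floor_le zero_le
    have hfl : (t : ℝ) * n < (m : ℝ) + 1 := by exact_mod_cast Nat.lt_floor_add_one ((t : ℝ≥0) * n)
    have hnR : (0 : ℝ) < n := by exact_mod_cast hn0
    calc (t : ℝ) * g 1 ≤ ((m : ℕ) / n : ℝ) * g 1 + g 1 / n := by
          have : (t : ℝ) ≤ (m : ℝ) / n + 1 / n := by
            rw [← add_div, le_div_iff₀ hnR]; exact hfl.le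
          calc (t : ℝ) * g 1 ≤ ((m : ℝ) / n + 1 / n) * g 1 := mul_le_mul_of_nonneg_right this hc0
            _ = ((m : ℕ) / n : ℝ) * g 1 + g 1 / n := by ring
      _ = g ((m : ℝ≥0) / n) + g 1 / n := by rw [hrat _ _ hn0]
      _ ≤ g t + g 1 / n := by gcongr; exact hmono hle
      _ < g t + ε := by
          gcongr
          rw [div_lt_iff₀ hnR]
          rw [div_lt_iff₀ hε] at hn
          linarith

/-- **`F(K_t) = e^{-2αt}` for some `α ≥ 0`** ([LSW] p. 11: "Since `F` is a homomorphism, this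
implies that `F(G_t) = exp(-2αt)` for some constant `α ≥ 0` and all `t ≥ 0`, or that `F(G_t) = 0`
for all `t > 0`. However, the latter possibility … is ruled out"): `t ↦ -log F(K_t)` is additive
and monotone on `[0, ∞)`, hence linear. [cite: LawlerSchrammWerner2003Restriction, Prop. 3.3 proof (p. 11)] -/
theorem exists_measure_avoid_lswHull_eq_exp [IsProbabilityMeasure P] (hmul : IsHullMultiplicative P) :
    ∃ α : ℝ, 0 ≤ α ∧ ∀ t : ℝ≥0, P (avoid (lswHull t)) = ENNReal.ofReal (Real.exp (-2 * α * t)) := by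
  set f : ℝ≥0 → ℝ := fun t ↦ (P (avoid (lswHull t))).toReal with hf
  have hf0 : ∀ t, 0 < f t := fun t ↦
    ENNReal.toReal_pos (measure_avoid_lswHull_ne_zero hmul t) (measure_ne_top _ _)
  have hf1 : ∀ t, f t ≤ 1 := fun t ↦ by
    rw [hf, ← ENNReal.toReal_one]
    exact ENNReal.toReal_mono ENNReal.one_ne_top prob_le_one
  have hfadd : ∀ s t, f (s + t) = f s * f t := fun s t ↦ by
    simp only [hf]
    rw [measure_avoid_lswHull_add hmul, ENNReal.toReal_mul, mul_comm]
  have hfanti : Antitone f := fun s t hst ↦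
    ENNReal.toReal_mono (measure_ne_top _ _) (measure_avoid_lswHull_antitone P hst)
  set g : ℝ≥0 → ℝ := fun t ↦ -Real.log (f t) with hg
  have hgmono : Monotone g := fun s t hst ↦ by
    simp only [hg, neg_le_neg_iff]
    exact Real.log_le_log (hf0 t) (hfanti hst)
  have hgadd : ∀ s t, g (s + t) = g s + g t := fun s t ↦ by
    simp only [hg]
    rw [hfadd, Real.log_mul (hf0 s).ne' (hf0 t).ne']
    ring
  have hglin := eq_mul_of_monotone_of_map_add hgmono hgadd
  have hc0 : 0 ≤ g 1 := by
    simp only [hg, Left.nonneg_neg_iff]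
    exact Real.log_nonpos (hf0 1).le (hf1 1)
  refine ⟨g 1 / 2, by positivity, fun t ↦ ?_⟩
  have h1 : P (avoid (lswHull t)) = ENNReal.ofReal (f t) := by
    rw [hf, ENNReal.ofReal_toReal (measure_ne_top _ _)]
  rw [h1]
  congr 1
  have h2 : f t = Real.exp (-g t) := by
    simp only [hg, neg_neg]
    rw [Real.exp_log (hf0 t)]
  rw [h2, hglin t]
  congr 1
  ring

end Semigroup

/-! ### `F = Φ'(0)^α` on `𝒬₊` (density of `𝒜₀` and continuity of `F`) -/

section Plus

variable {P : Measure RestrictionConfig} [IsProbabilityMeasure P]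

/-- **`F(Φ_A) = Φ_A'(0)^α` for every `A ∈ 𝒬₊`** ([LSW] (3.3), p. 11: "To deduce that
`∀ A ∈ 𝒬₊, F(Φ_A) = Φ_A'(0)^α`, we rely on the following lemma [3.5]"): given `F(K_t) = e^{-2αt}`,
the identity holds on `𝒜₀` (`IsLSWGenerated.measure_avoid_eq_rpow`) and passes to the limit along
`A_n → A`, `A_n ∈ 𝒜₀` (density fact `hdense`), by the continuity of `F` (fact `hcont`) and of
`Φ'(0)` (`LSWConverges.tendsto_restrictionDeriv`).
[cite: LawlerSchrammWerner2003Restriction, Prop. 3.3 proof, (3.3) via Lemma 3.5 (pp. 11–12)] -/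
theorem measure_avoid_eq_rpow_of_isPlusHull (hcont : LSWConverges.tendsto_measure_avoid)
    (hdense : IsPlusHull.exists_isLSWGenerated_lswConverges) (hsc : IsScaleInvariant P)
    (hmul : IsHullMultiplicative P) {α : ℝ}
    (hK : ∀ t : ℝ≥0, P (avoid (lswHull t)) = ENNReal.ofReal (Real.exp (-2 * α * t)))
    {A : Set ℂ} (hA : IsPlusHull A) {Φ : ConformalEquiv (upperHalfPlaneSet \ A) upperHalfPlaneSet}
    (hΦ : IsRestrictionMap A Φ) {d : ℝ} (hd : HasRestrictionDeriv A Φ d) :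
    P (avoid A) = ENNReal.ofReal (d ^ α) := by
  obtain ⟨An, Φn, hgen, hΦn, hconv⟩ := hdense hA hΦ
  have hAn : ∀ n, IsPlusHull (An n) := fun n ↦ (hgen n).isPlusHull
  choose dn _ _ hdn using fun n ↦ IsStarHull.exists_hasRestrictionDeriv_holds (hAn n).1 (hΦn n)
  have h1 : Tendsto (fun n ↦ P (avoid (An n))) atTop (𝓝 (P (avoid A))) :=
    hcont P inferInstance hsc hmul hA hΦ hAn hΦn hconv
  have h2 : ∀ n, P (avoid (An n)) = ENNReal.ofReal (dn n ^ α) := fun n ↦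
    (hgen n).measure_avoid_eq_rpow hmul hsc hK (hΦn n) (hdn n)
  have h3 : Tendsto dn atTop (𝓝 d) :=
    hconv.tendsto_restrictionDeriv hA.1 (fun n ↦ (hAn n).1) hΦ hΦn hd hdn
  obtain ⟨d', hd'0, -, hd'⟩ := IsStarHull.exists_hasRestrictionDeriv_holds hA.1 hΦ
  have hd0 : 0 < d := (hd.unique hA.1 hd') ▸ hd'0
  have h4 : Tendsto (fun n ↦ ENNReal.ofReal (dn n ^ α)) atTop (𝓝 (ENNReal.ofReal (d ^ α))) :=
    ENNReal.tendsto_ofReal (h3.rpow_const (Or.inl hd0.ne'))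
  simp_rw [h2] at h1
  exact tendsto_nhds_unique h1 h4

/-- **`F = Φ'(0)^α` on `𝒬₊` for some `α ≥ 0`**, for every probability measure on `Ω` satisfying
(1) ([LSW] (3.3), p. 11). [cite: LawlerSchrammWerner2003Restriction, Prop. 3.3 proof, (3.3) (p. 11)] -/
theorem exists_measure_avoid_eq_rpow_of_isPlusHull (hcont : LSWConverges.tendsto_measure_avoid)
    (hdense : IsPlusHull.exists_isLSWGenerated_lswConverges) (hsc : IsScaleInvariant P)
    (hmul : IsHullMultiplicative P) :
    ∃ α : ℝ, 0 ≤ α ∧ ∀ {A : Set ℂ}, IsPlusHull A →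
      ∀ {Φ : ConformalEquiv (upperHalfPlaneSet \ A) upperHalfPlaneSet}, IsRestrictionMap A Φ →
        ∀ {d : ℝ}, HasRestrictionDeriv A Φ d → P (avoid A) = ENNReal.ofReal (d ^ α) := by
  obtain ⟨α, hα0, hK⟩ := exists_measure_avoid_lswHull_eq_exp hmul
  exact ⟨α, hα0, fun hA _ hΦ _ hd ↦ measure_avoid_eq_rpow_of_isPlusHull hcont hdense hsc hmul hK hA hΦ hd⟩

/-- **`F = Φ'(0)^{α₋}` on `𝒬₋` for some `α₋ ≥ 0`** ([LSW] p. 13: "By symmetry, there is a constant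
`α₋` such that `F(A) = Φ_A'(0)^{α₋}` holds for every `A ∈ 𝒬₋`"): apply the `𝒬₊` statement to the
mirror image `σ_* P`, which again satisfies (1), and use `F_{σ_*P}(σA) = F_P(A)`,
`Φ'_{σA}(0) = Φ'_A(0)`. [cite: LawlerSchrammWerner2003Restriction, Prop. 3.3 proof (p. 13), α₋ by symmetry] -/
theorem exists_measure_avoid_eq_rpow_of_isMinusHull (hcont : LSWConverges.tendsto_measure_avoid)
    (hdense : IsPlusHull.exists_isLSWGenerated_lswConverges) (hsc : IsScaleInvariant P)
    (hmul : IsHullMultiplicative P) :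
    ∃ β : ℝ, 0 ≤ β ∧ ∀ {A : Set ℂ}, IsMinusHull A →
      ∀ {Φ : ConformalEquiv (upperHalfPlaneSet \ A) upperHalfPlaneSet}, IsRestrictionMap A Φ →
        ∀ {d : ℝ}, HasRestrictionDeriv A Φ d → P (avoid A) = ENNReal.ofReal (d ^ β) := by
  haveI : IsProbabilityMeasure (P.map reflect) :=
    Measure.isProbabilityMeasure_map measurable_reflect.aemeasurable
  obtain ⟨β, hβ0, hβ⟩ := exists_measure_avoid_eq_rpow_of_isPlusHull (P := P.map reflect) hcont hdense
    hsc.map_reflect hmul.map_reflect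
  refine ⟨β, hβ0, fun {A} hA Φ hΦ d hd ↦ ?_⟩
  have hAc : IsClosed A := hA.1.isBoundedHull.isClosed
  have := hβ hA.image_imagAxisRefl (hΦ.reflectHull hAc) (hd.reflectHull hAc)
  rwa [map_reflect_avoid P hA.1.image_imagAxisRefl, imagAxisRefl_image_image] at this

end Plus

/-! ### `α₋ = α`: the symmetric pair of arcs -/

section Arcs

/-- The arc hull `circArcHull (-2) q` is the single arc `{e^{iθ} : 2 cos θ ≥ q}` attached to `1`
(for points of `ℍ` on the unit circle `2 Re z > -2`). [folklore] -/
theorem circArcHull_neg_two_subset (q : ℝ) :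
    circArcHull (-2) q ⊆ {z : ℂ | ‖z‖ = 1 ∧ q ≤ 2 * z.re} := by
  refine closure_minimal (fun z hz ↦ ⟨hz.2.1, ?_⟩) ?_
  · rcases hz.2.2 with h | h
    · have := abs_re_lt_one hz.1 hz.2.1
      rw [abs_lt] at this
      linarith
    · exact h
  · exact (isClosed_eq continuous_norm continuous_const).inter
      (isClosed_le continuous_const (continuous_const.mul Complex.continuous_re))

/-- **The single arcs are `+`-hulls**: `circArcHull (-2) q ∈ 𝒬₊` for `-2 < q ≤ 2` (its only real
point is `1`). [cite: LawlerSchrammWerner2003Restriction, Prop. 3.3 proof (p. 13), A₊ ∈ 𝒬₊] -/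
theorem isPlusHull_circArcHull_neg_two {q : ℝ} (hq : -2 < q) (hq2 : q ≤ 2) :
    IsPlusHull (circArcHull (-2) q) := by
  refine ⟨isStarHull_circArcHull le_rfl hq hq2, fun x hx ↦ ?_⟩
  obtain ⟨h1, h2⟩ := circArcHull_neg_two_subset q hx
  simp only [Complex.norm_real, Real.norm_eq_abs, Complex.ofReal_re] at h1 h2
  rcases abs_eq (zero_le_one) |>.1 h1 with rfl | rfl
  · exact one_pos
  · linarith

/-- The symmetric pair of arcs is the union of its two arcs:
`circArcHull (-1) 1 = circArcHull (-1) 2 ∪ circArcHull (-2) 1`. [folklore] -/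
theorem circArcHull_neg_one_one : circArcHull (-1) 1 = circArcHull (-1) 2 ∪ circArcHull (-2) 1 := by
  rw [circArcHull, circArcHull, circArcHull, ← closure_union]
  congr 1
  ext z
  simp only [circArcCore, mem_setOf_eq, mem_union]
  constructor
  · rintro ⟨hz, h1, h | h⟩
    · exact Or.inl ⟨hz, h1, Or.inl h⟩
    · exact Or.inr ⟨hz, h1, Or.inr h⟩
  · rintro (⟨hz, h1, h | h⟩ | ⟨hz, h1, h | h⟩)
    · exact ⟨hz, h1, Or.inl h⟩
    · have := abs_re_lt_one hz h1; rw [abs_lt] at this; linarith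
    · have := abs_re_lt_one hz h1; rw [abs_lt] at this; linarith
    · exact ⟨hz, h1, Or.inr h⟩

/-- `σ(circArcHull p q) = circArcHull (-q) (-p)`. [folklore] -/
theorem imagAxisRefl_image_circArcHull (p q : ℝ) :
    imagAxisRefl '' circArcHull p q = circArcHull (-q) (-p) := by
  rw [circArcHull, circArcHull, imagAxisRefl.image_closure]
  congr 1
  ext z
  rw [← imagAxisRefl_preimage, mem_preimage]
  simp only [circArcCore, mem_setOf_eq, norm_imagAxisRefl, imagAxisRefl_re]
  constructor
  · rintro ⟨hz, h1, h | h⟩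
    · exact ⟨by simpa [upperHalfPlaneSet] using hz, h1, Or.inr (by linarith)⟩
    · exact ⟨by simpa [upperHalfPlaneSet] using hz, h1, Or.inl (by linarith)⟩
  · rintro ⟨hz, h1, h | h⟩
    · exact ⟨by simpa [upperHalfPlaneSet] using hz, h1, Or.inr (by linarith)⟩
    · exact ⟨by simpa [upperHalfPlaneSet] using hz, h1, Or.inl (by linarith)⟩

/-- `-1` lies on the left arc `circArcHull (-1) 2` (limit of `e^{iθ}`, `θ ↑ π`). [folklore] -/
theorem neg_one_mem_circArcHull : (-1 : ℂ) ∈ circArcHull (-1) 2 := by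
  have hpath : Tendsto (fun θ : ℝ ↦ Complex.exp (θ * I)) (𝓝[<] Real.pi) (𝓝 (-1)) := by
    have : Continuous fun θ : ℝ ↦ Complex.exp (θ * I) := by fun_prop
    have h : Tendsto (fun θ : ℝ ↦ Complex.exp (θ * I)) (𝓝[<] Real.pi)
        (𝓝 (Complex.exp ((Real.pi : ℝ) * I))) :=
      (this.tendsto Real.pi).mono_left nhdsWithin_le_nhds
    rwa [Complex.exp_pi_mul_I] at h
  refine mem_closure_of_tendsto hpath ?_
  have hev : ∀ᶠ θ : ℝ in 𝓝[<] Real.pi, 2 * Real.pi / 3 < θ :=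
    nhdsWithin_le_nhds (eventually_gt_nhds (by linarith [Real.pi_pos]))
  filter_upwards [hev, self_mem_nhdsWithin] with θ hθ hθπ
  have hθπ : θ < Real.pi := hθπ
  refine ⟨?_, ?_, Or.inl ?_⟩
  · show 0 < (Complex.exp (θ * I)).im
    rw [Complex.exp_ofReal_mul_I_im]
    exact Real.sin_pos_of_pos_of_lt_pi (by linarith [Real.pi_pos]) hθπ
  · exact Complex.norm_exp_ofReal_mul_I θ
  · rw [Complex.exp_ofReal_mul_I_re]
    have : Real.cos θ < Real.cos (2 * Real.pi / 3) :=
      Real.cos_lt_cos_of_nonneg_of_le_pi (by linarith [Real.pi_pos]) hθπ.le hθ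
    have h23 : Real.cos (2 * Real.pi / 3) = -1 / 2 := by
      rw [show 2 * Real.pi / 3 = Real.pi - Real.pi / 3 by ring, Real.cos_pi_sub, Real.cos_pi_div_three]
      ring
    linarith

/-- The `−`-part of the symmetric pair of arcs lies in the left arc. [folklore] -/
theorem sidePart_circArcHull_subset :
    sidePart (circArcHull (-1) 1) (-1) ⊆ circArcHull (-1) 2 := by
  intro a ha
  obtain ⟨C, hC, hCconn, haC, x, hx, hxC⟩ := exists_isPreconnected_of_mem_sidePart ha
  have hCA : C ⊆ circArcHull (-1) 1 := hC.trans (sidePart_subset _ _)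
  -- `C` is a preconnected subset of `{Re < 0} ∪ {Re > 0}` meeting `{Re < 0}`
  have hsub : C ⊆ {z : ℂ | z.re < 0} ∪ {z : ℂ | 0 < z.re} := fun z hz ↦ by
    rcases (circArcHull_subset (hCA hz)).2 with h | h
    · exact Or.inl (by simp only [mem_setOf_eq]; linarith)
    · exact Or.inr (by simp only [mem_setOf_eq]; linarith)
  have hCl : C ⊆ {z : ℂ | z.re < 0} :=
    hCconn.subset_left_of_subset_union (isOpen_lt Complex.continuous_re continuous_const)
      (isOpen_lt continuous_const Complex.continuous_re)
      (Set.disjoint_left.2 fun z (h1 : z.re < 0) (h2 : 0 < z.re) ↦ by linarith) hsub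
      ⟨x, hxC, by simp only [mem_setOf_eq, Complex.ofReal_re]; nlinarith⟩
  have ha0 : a.re < 0 := hCl haC
  rcases (circArcHull_neg_one_one ▸ hCA haC : a ∈ circArcHull (-1) 2 ∪ circArcHull (-2) 1) with h | h
  · exact h
  · have := (circArcHull_neg_two_subset 1 h).2
    linarith

variable {P : Measure RestrictionConfig}

/-- **`α₋ = α`** ([LSW] end of the proof of Prop. 3.3, p. 13: "To verify that `α₋ = α`, let …
`A₊ = {e^{iθ} : θ ∈ [0, π/2 - ε]}`, `A₋ = {e^{iθ} : θ ∈ [π/2 + ε, π]}` and `A = A₊ ∪ A₋`. …"). We run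
the argument with `ε = π/3`, i.e. `A = circArcHull (-1) 1` (`Φ_A'(0) = 1/4`,
`hasRestrictionDeriv_joukowskiArcMap`): `A = A₁ · A₂` with `A₂ = A₋`, `A₁ = Φ_{A₋}(A₊) ∈ 𝒬₊`
(`IsStarHull.isHullProduct_plusImage`), and by reflection `A = σ(A) = σ(A₁) · σ(A₂)`; applying
`F` gives `d₁^α d₂^{α₋} = d₁^{α₋} d₂^α` for `dᵢ = Φ'_{Aᵢ}(0)`, whence `α = α₋` unless `d₁ = d₂` — but
`d₁ d₂ = 1/4` (chain rule) and `d₂ ≥ Φ'_{A₋}(0) = 9/16` (`A₂ ⊆ A₋`, monotonicity), so `d₁ < d₂`.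
[cite: LawlerSchrammWerner2003Restriction, Prop. 3.3 proof (p. 13), α₋ = α] -/
theorem restrictionExponent_minus_eq (hmul : IsHullMultiplicative P) {α β : ℝ}
    (hplus : ∀ {A : Set ℂ}, IsPlusHull A →
      ∀ {Φ : ConformalEquiv (upperHalfPlaneSet \ A) upperHalfPlaneSet}, IsRestrictionMap A Φ →
        ∀ {d : ℝ}, HasRestrictionDeriv A Φ d → P (avoid A) = ENNReal.ofReal (d ^ α))
    (hminus : ∀ {A : Set ℂ}, IsMinusHull A →
      ∀ {Φ : ConformalEquiv (upperHalfPlaneSet \ A) upperHalfPlaneSet}, IsRestrictionMap A Φ →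
        ∀ {d : ℝ}, HasRestrictionDeriv A Φ d → P (avoid A) = ENNReal.ofReal (d ^ β)) :
    β = α := by
  -- the symmetric pair of arcs and its factorisation `A = A₁ · A₂`
  have hA : IsStarHull (circArcHull (-1) 1) := isStarHull_circArcHull (by norm_num) (by norm_num) (by norm_num)
  have hdA := hasRestrictionDeriv_joukowskiArcMap (p := -1) (q := 1) (by norm_num) (by norm_num) (by norm_num)
  have hΦA := isRestrictionMap_joukowskiArcMap (p := -1) (q := 1) (by norm_num) (by norm_num) (by norm_num)
  have hne : (sidePart (circArcHull (-1) 1) (-1)).Nonempty :=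
    ⟨(-1 : ℝ), ofReal_mem_sidePart (by norm_num) (by
      rw [circArcHull_neg_one_one]; exact Or.inl (by exact_mod_cast neg_one_mem_circArcHull))⟩
  have hA₁ : IsPlusHull (hA.plusImage hne) := hA.isPlusHull_plusImage hne
  have hA₂ : IsMinusHull (sidePart (circArcHull (-1) 1) (-1)) := hA.isMinusHull_minusPart
  have hprod := hA.isHullProduct_plusImage hne
  obtain ⟨Φ₁, hΦ₁, -⟩ := IsStarHull.existsUnique_isRestrictionMap_holds hA₁.1
  obtain ⟨d₁, hd₁0, -, hd₁⟩ := IsStarHull.exists_hasRestrictionDeriv_holds hA₁.1 hΦ₁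
  obtain ⟨Φ₂, hΦ₂, -⟩ := IsStarHull.existsUnique_isRestrictionMap_holds hA₂.1
  obtain ⟨d₂, hd₂0, -, hd₂⟩ := IsStarHull.exists_hasRestrictionDeriv_holds hA₂.1 hΦ₂
  -- `1/4 = d₁ d₂` and `9/16 ≤ d₂`
  have hchain : ((1 - (-1)) / 4) ^ 2 = d₁ * d₂ :=
    IsHullProduct.restrictionDeriv_eq hA₁.1 hA₂.1 hprod hΦ₁ hΦ₂ hΦA hd₁ hd₂ hdA
  have hL : IsStarHull (circArcHull (-1) 2) := isStarHull_circArcHull (by norm_num) (by norm_num) le_rfl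
  have hdL := hasRestrictionDeriv_joukowskiArcMap (p := -1) (q := 2) (by norm_num) (by norm_num) le_rfl
  have hΦL := isRestrictionMap_joukowskiArcMap (p := -1) (q := 2) (by norm_num) (by norm_num) le_rfl
  have hle : ((2 - (-1)) / 4) ^ 2 ≤ d₂ :=
    HasRestrictionDeriv.le_of_subset hL hA₂.1 sidePart_circArcHull_subset hΦL hΦ₂ hdL hd₂
  have hlt : d₁ < d₂ := by nlinarith
  -- `F(A)` computed from the two factorisations
  have e1 : P (avoid (circArcHull (-1) 1)) = ENNReal.ofReal (d₁ ^ α) * ENNReal.ofReal (d₂ ^ β) := by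
    rw [hmul _ _ _ hA₁.1 hA₂.1 hprod, hplus hA₁ hΦ₁ hd₁, hminus hA₂ hΦ₂ hd₂]
  have hsymm : imagAxisRefl '' circArcHull (-1) 1 = circArcHull (-1) 1 := by
    rw [imagAxisRefl_image_circArcHull]; norm_num
  have hprod' := hprod.image_imagAxisRefl hA₂.1
  rw [hsymm] at hprod'
  have hA₁c : IsClosed (hA.plusImage hne) := hA₁.1.isBoundedHull.isClosed
  have hA₂c : IsClosed (sidePart (circArcHull (-1) 1) (-1)) := hA₂.1.isBoundedHull.isClosed
  have e2 : P (avoid (circArcHull (-1) 1)) = ENNReal.ofReal (d₁ ^ β) * ENNReal.ofReal (d₂ ^ α) := by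
    rw [hmul _ _ _ hA₁.1.image_imagAxisRefl hA₂.1.image_imagAxisRefl hprod',
      hminus hA₁.image_imagAxisRefl (hΦ₁.reflectHull hA₁c) (hd₁.reflectHull hA₁c),
      hplus hA₂.image_imagAxisRefl (hΦ₂.reflectHull hA₂c) (hd₂.reflectHull hA₂c)]
  have e3 : d₁ ^ α * d₂ ^ β = d₁ ^ β * d₂ ^ α := by
    have h := e1.symm.trans e2
    rw [← ENNReal.ofReal_mul (Real.rpow_nonneg hd₁0.le _),
      ← ENNReal.ofReal_mul (Real.rpow_nonneg hd₁0.le _)] at h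
    exact (ENNReal.ofReal_eq_ofReal_iff (mul_nonneg (Real.rpow_nonneg hd₁0.le _) (Real.rpow_nonneg hd₂0.le _))
      (mul_nonneg (Real.rpow_nonneg hd₁0.le _) (Real.rpow_nonneg hd₂0.le _))).1 h
  -- take logarithms
  have hlog := congrArg Real.log e3
  rw [Real.log_mul (Real.rpow_pos_of_pos hd₁0 _).ne' (Real.rpow_pos_of_pos hd₂0 _).ne',
    Real.log_mul (Real.rpow_pos_of_pos hd₁0 _).ne' (Real.rpow_pos_of_pos hd₂0 _).ne',
    Real.log_rpow hd₁0, Real.log_rpow hd₂0, Real.log_rpow hd₁0, Real.log_rpow hd₂0] at hlog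
  have hloglt : Real.log d₁ < Real.log d₂ := Real.log_lt_log hd₁0 hlt
  have : (α - β) * (Real.log d₁ - Real.log d₂) = 0 := by linarith
  rcases mul_eq_zero.1 this with h | h
  · linarith
  · linarith

end Arcs

/-! ### `α > 0` and the assembly of Prop. 3.3 (1) ⇒ (3) -/

section Assembly

variable {P : Measure RestrictionConfig} [IsProbabilityMeasure P]

/-- **`α > 0`** ([LSW] p. 13: "The case `α = 0` clearly implies `K = ∅` a.s., which is not
permitted"): if `F(A) = 1` for all the arcs `circArcHull (-2) q`, `q ↓ -2` (which exhaust the unit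
semicircle), then a.s. `K` misses the unit semicircle, contradicting `exists_mem_norm_eq_one`.
[cite: LawlerSchrammWerner2003Restriction, Prop. 3.3 proof (p. 13), α > 0] -/
theorem restrictionExponent_pos {α : ℝ} (hα : 0 ≤ α)
    (hplus : ∀ {A : Set ℂ}, IsPlusHull A →
      ∀ {Φ : ConformalEquiv (upperHalfPlaneSet \ A) upperHalfPlaneSet}, IsRestrictionMap A Φ →
        ∀ {d : ℝ}, HasRestrictionDeriv A Φ d → P (avoid A) = ENNReal.ofReal (d ^ α)) :
    0 < α := by
  rcases hα.lt_or_eq with h | h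
  · exact h
  exfalso
  subst h
  -- the arcs `H_n = circArcHull (-2) (-2 + 1/(n+1))` have `F(H_n) = 1`
  set q : ℕ → ℝ := fun n ↦ -2 + 1 / ((n : ℝ) + 1) with hq
  have hq1 : ∀ n, -2 < q n := fun n ↦ by
    have : (0 : ℝ) < 1 / ((n : ℝ) + 1) := by positivity
    simp only [hq]; linarith
  have hq2 : ∀ n, q n ≤ 2 := fun n ↦ by
    simp only [hq]
    have : 1 / ((n : ℝ) + 1) ≤ 1 := by rw [div_le_one (by positivity)]; linarith [n.cast_nonneg (α := ℝ)]
    linarith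
  have hF : ∀ n, P (avoid (circArcHull (-2) (q n))) = 1 := fun n ↦ by
    rw [hplus (isPlusHull_circArcHull_neg_two (hq1 n) (hq2 n))
      (isRestrictionMap_joukowskiArcMap le_rfl (hq1 n) (hq2 n))
      (hasRestrictionDeriv_joukowskiArcMap le_rfl (hq1 n) (hq2 n)), Real.rpow_zero, ENNReal.ofReal_one]
  -- hence a.s. `K` misses all of them
  have hae : ∀ᵐ K ∂P, ∀ n, K ∈ avoid (circArcHull (-2) (q n)) := by
    rw [ae_all_iff]
    intro n
    have hS : MeasurableSet (avoid (circArcHull (-2) (q n))) :=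
      measurableSet_avoid (isStarHull_circArcHull le_rfl (hq1 n) (hq2 n))
    have h0 : P (avoid (circArcHull (-2) (q n)))ᶜ = 0 := (prob_compl_eq_zero_iff hS).2 (hF n)
    exact mem_ae_iff.2 h0
  -- but every `K` meets the unit semicircle, which the arcs exhaust
  have hfalse : ∀ᵐ K ∂P, False := by
    filter_upwards [hae] with K hK
    obtain ⟨z, hzK, hz1⟩ := K.exists_mem_norm_eq_one
    have hzH : z ∈ upperHalfPlaneSet := K.subset_upperHalfPlaneSet hzK
    have hre : -1 < z.re := by
      have := abs_re_lt_one hzH hz1; rw [abs_lt] at this; exact this.1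
    obtain ⟨n, hn⟩ := exists_nat_one_div_lt (show (0 : ℝ) < 2 * z.re + 2 by linarith)
    have hzcore : z ∈ circArcHull (-2) (q n) :=
      subset_closure ⟨hzH, hz1, Or.inr (by simp only [hq]; linarith)⟩
    exact Set.disjoint_left.1 (hK n) hzK hzcore
  exact absurd (ae_iff.1 hfalse) (by simp)

/-- **[LSW] Proposition 3.3, (1) ⇒ (3), from Lemma 3.5** (its continuity clause `hcont` and its
density clause `hdense`, both named facts): a probability measure on `Ω` which is
dilation-invariant and multiplicative over products is `P_α` for some `α > 0`. Assembly as in the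
printed proof (pp. 11–13): `F(K_t) = e^{-2αt}` (`exists_measure_avoid_lswHull_eq_exp`),
`F = Φ'(0)^α` on `𝒜₀`, on `𝒬₊` (Lemma 3.5), on `𝒬₋` with an exponent `α₋` (symmetry), `α₋ = α`
(`restrictionExponent_minus_eq`), on `𝒬*` via `A = A₁ · A₂` (`IsStarHull.exists_isHullProduct_plus_minus_holds`)
and `Φ'_{A₁·A₂}(0) = Φ'_{A₁}(0) Φ'_{A₂}(0)`; finally `α > 0` (`restrictionExponent_pos`).
[cite: LawlerSchrammWerner2003Restriction, Prop. 3.3 (1) ⇒ (3) (pp. 10–13)] -/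
theorem exists_isRestrictionMeasure_of_isHullMultiplicative_of_lemma35
    (hcont : LSWConverges.tendsto_measure_avoid)
    (hdense : IsPlusHull.exists_isLSWGenerated_lswConverges) :
    exists_isRestrictionMeasure_of_isHullMultiplicative := by
  intro P hP hsc hmul
  obtain ⟨α, hα0, hplus⟩ := exists_measure_avoid_eq_rpow_of_isPlusHull hcont hdense hsc hmul
  obtain ⟨β, -, hminus⟩ := exists_measure_avoid_eq_rpow_of_isMinusHull hcont hdense hsc hmul
  have hβ : β = α := restrictionExponent_minus_eq hmul hplus hminus
  subst hβ
  refine ⟨β, restrictionExponent_pos hα0 hplus, hP, fun {A} hA Φ hΦ d hd ↦ ?_⟩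
  obtain ⟨A₁, A₂, hA₁, hA₂, hprod⟩ := IsStarHull.exists_isHullProduct_plus_minus_holds hA
  obtain ⟨Φ₁, hΦ₁, -⟩ := IsStarHull.existsUnique_isRestrictionMap_holds hA₁.1
  obtain ⟨d₁, hd₁0, -, hd₁⟩ := IsStarHull.exists_hasRestrictionDeriv_holds hA₁.1 hΦ₁
  obtain ⟨Φ₂, hΦ₂, -⟩ := IsStarHull.existsUnique_isRestrictionMap_holds hA₂.1
  obtain ⟨d₂, hd₂0, -, hd₂⟩ := IsStarHull.exists_hasRestrictionDeriv_holds hA₂.1 hΦ₂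
  have hd12 : d = d₁ * d₂ := IsHullProduct.restrictionDeriv_eq hA₁.1 hA₂.1 hprod hΦ₁ hΦ₂ hΦ hd₁ hd₂ hd
  rw [hmul _ _ _ hA₁.1 hA₂.1 hprod, hplus hA₁ hΦ₁ hd₁, hminus hA₂ hΦ₂ hd₂, hd12,
    ← ENNReal.ofReal_mul (Real.rpow_nonneg hd₁0.le _), Real.mul_rpow hd₁0.le hd₂0.le]

end Assembly

end Literature.Probability.RandomPlanarGeometry

end
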